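import Summits.AtomisticToContinuum.Crystallization.Theorems.PalmUnimodularRigidityLayeredLawsSelectHcpBallPositions

/-!
# Crux `LayeredLawsSelectHcp` (stmt-AtomisticToContinuum-9226), line `mtp-prestress-split-ergodic-frame`:
# a-priori range of the label lengths `‖X u‖` on the graph balls (`tube_ballRange`, DR)

Registered sub-goal `tube_ballRange` (DR of the far-field memo `Cruxes/LayeredLawsSelectHcp/LeadC3FarField.md`,
§1, §5, §9): the law part of the certificate needs, for every label `u` of moderate graph norm, an a-priori interval
for the length `‖X u‖` of the labelled atom of a rooted chart `X`, valid pointwise on every every-point-good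
hcp-charted configuration.  This file turns the landed dead-reckoning position bound `ball_positions`
(`‖X u − a • A (Pᵢ u)‖ ≤ n a/100 + n (n − 1) · 251/10000` on `ballLabels n` for the frame `(a, A)`, `a ∈ [9/10, 1]`,
of `tube_chartStarFrame`; `Pᵢ = hcpSite 1 √(2/3)`) into exactly that interval:

* `norm_range_of_frameFit`: `‖x − a • A y‖ ≤ D`, `0 ≤ a` give `a ‖y‖ − D ≤ ‖x‖ ≤ a ‖y‖ + D` (`A` an isometry);
* `tube_ballRange_frame`: ONE scale `a ∈ [9/10, 1]` for the whole configuration with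
  `a ‖Pᵢ u‖ − (n a/100 + n (n − 1) · 251/10000) ≤ ‖X u‖ ≤ a ‖Pᵢ u‖ + (n a/100 + n (n − 1) · 251/10000)` on every
  `ballLabels n` (the relative form);
* `tube_ballRange` (registered): the frame-free form
  `9/10 · (‖Pᵢ u‖ − n/100) − n (n − 1) · 251/10000 ≤ ‖X u‖ ≤ ‖Pᵢ u‖ + n/100 + n (n − 1) · 251/10000` on `ballLabels n`
  (lower: `a ≥ 9/10` when `‖Pᵢ u‖ ≥ n/100`, else the left side is negative; upper: `a ≤ 1`);
* `tube_ballRange_sq`: the same for the squared lengths.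

The radius `n` is a variable throughout (no closed ball `ballLabels 3`, `ballLabels 4` is ever unfolded).
All `[folklore]`.
-/

noncomputable section

namespace Summit.AtomisticToContinuum.Crystallization.Theorems.PalmUnimodularRigidity.LayeredLawsSelectHcp

open MeasureTheory Set
open Literature.MathematicalPhysics.StatisticalMechanics Literature.Geometry.DiscreteGeometry
open Summit.AtomisticToContinuum.Crystallization.Theorems.LayeredLawsSelectHcp.Negative.DiracLaws (GoodShell)
open LocalChartIffBall

/-! ## Norm bookkeeping -/

/-- **Lengths from a frame fit**: if `x` is within `D` of `a • A y` for a scale `a ≥ 0` and a linear isometry `A`,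
then `a ‖y‖ − D ≤ ‖x‖ ≤ a ‖y‖ + D` (triangle inequality, `‖a • A y‖ = a ‖y‖`). [folklore] -/
theorem norm_range_of_frameFit {a D : ℝ} (ha : 0 ≤ a)
    (A : EuclideanSpace ℝ (Fin 3) ≃ₗᵢ[ℝ] EuclideanSpace ℝ (Fin 3)) {x y : EuclideanSpace ℝ (Fin 3)}
    (h : ‖x - a • A y‖ ≤ D) : a * ‖y‖ - D ≤ ‖x‖ ∧ ‖x‖ ≤ a * ‖y‖ + D := by
  have e : ‖a • A y‖ = a * ‖y‖ := by
    rw [norm_smul, Real.norm_eq_abs, abs_of_nonneg ha, LinearIsometryEquiv.norm_map]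
  have h1 := norm_le_norm_add_norm_sub (x) (a • A y)
  have h2 := norm_le_norm_add_norm_sub' (x) (a • A y)
  rw [e] at h1 h2
  constructor <;> linarith

/-! ## The range lemmas -/

/-- **Range of the label lengths relative to the root scale.**  For an every-point-good hcp-charted `S` and a rooted
labelled chart `X` of `S` there is ONE scale `a ∈ [9/10, 1]` (that of the frame of `tube_chartStarFrame`) with
`a ‖Pᵢ u‖ − (n a/100 + n (n − 1) · 251/10000) ≤ ‖X u‖ ≤ a ‖Pᵢ u‖ + (n a/100 + n (n − 1) · 251/10000)` for every
`u ∈ ballLabels n` and every radius `n` (`ball_positions` and `norm_range_of_frameFit`). [folklore] -/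
theorem tube_ballRange_frame {S : Set (EuclideanSpace ℝ (Fin 3))} (hgood : ∀ x ∈ S, GoodShell S x)
    (hch : HcpCharted S) {X : ℤ × ℤ × ℤ → EuclideanSpace ℝ (Fin 3)} (hX : IsRootedChart S X) :
    ∃ a : ℝ, 9 / 10 ≤ a ∧ a ≤ 1 ∧ ∀ n : ℕ, ∀ u ∈ ballLabels n,
      a * ‖hcpSite 1 (Real.sqrt (2 / 3)) u‖ - (n * a / 100 + n * ((n : ℝ) - 1) * 251 / 10000) ≤ ‖X u‖ ∧
      ‖X u‖ ≤ a * ‖hcpSite 1 (Real.sqrt (2 / 3)) u‖ + (n * a / 100 + n * ((n : ℝ) - 1) * 251 / 10000) := by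
  obtain ⟨a, h9, h1, A, hA⟩ := tube_chartStarFrame S hgood hch X hX
  refine ⟨a, h9, h1, fun n u hu => ?_⟩
  exact norm_range_of_frameFit (by linarith) A (ball_positions hgood hch hX h9 h1 hA n u hu)

/-- **Registered sub-goal `tube_ballRange` (DR): a-priori range of the label lengths on the graph balls.**  For an
every-point-good hcp-charted `S`, a rooted labelled chart `X` of `S`, a radius `n` and a label `u ∈ ballLabels n`,
`9/10 · (‖Pᵢ u‖ − n/100) − n (n − 1) · 251/10000 ≤ ‖X u‖ ≤ ‖Pᵢ u‖ + n/100 + n (n − 1) · 251/10000`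
(`Pᵢ = hcpSite 1 √(2/3)`): by `tube_ballRange_frame`, `‖X u‖` is within `n a/100 + n (n − 1) · 251/10000` of
`a ‖Pᵢ u‖` for a scale `a ∈ [9/10, 1]`; the upper bound uses `a ≤ 1`, the lower bound `a ≥ 9/10` when
`‖Pᵢ u‖ ≥ n/100` and `‖X u‖ ≥ 0` otherwise. [folklore] -/
theorem tube_ballRange : ∀ (S : Set (EuclideanSpace ℝ (Fin 3))), (∀ x ∈ S, GoodShell S x) → HcpCharted S → ∀ X : ℤ × ℤ × ℤ → EuclideanSpace ℝ (Fin 3), IsRootedChart S X → ∀ (n : ℕ), ∀ u ∈ ballLabels n, 9 / 10 * (‖hcpSite 1 (Real.sqrt (2 / 3)) u‖ - (n : ℝ) / 100) - (n : ℝ) * ((n : ℝ) - 1) * (251 / 10000) ≤ ‖X u‖ ∧ ‖X u‖ ≤ ‖hcpSite 1 (Real.sqrt (2 / 3)) u‖ + (n : ℝ) / 100 + (n : ℝ) * ((n : ℝ) - 1) * (251 / 10000) := by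
  intro S hgood hch X hX n u hu
  obtain ⟨a, h9, h1, h⟩ := tube_ballRange_frame hgood hch hX
  obtain ⟨hlo, hhi⟩ := h n u hu
  have hr : 0 ≤ ‖hcpSite 1 (Real.sqrt (2 / 3)) u‖ := norm_nonneg _
  have hn : (0 : ℝ) ≤ n := n.cast_nonneg
  have hd : (0 : ℝ) ≤ n * ((n : ℝ) - 1) := by
    rcases Nat.eq_zero_or_pos n with rfl | hpos
    · simp
    · have : (1 : ℝ) ≤ n := by exact_mod_cast hpos
      nlinarith
  refine ⟨?_, by nlinarith⟩
  by_cases hc : (n : ℝ) / 100 ≤ ‖hcpSite 1 (Real.sqrt (2 / 3)) u‖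
  · nlinarith
  · rw [not_le] at hc
    nlinarith [norm_nonneg (X u)]

/-- **Squared form of `tube_ballRange`**: on `ballLabels n`,
`(9/10 · (‖Pᵢ u‖ − n/100) − n (n − 1) · 251/10000)² ≤ ‖X u‖²` as soon as the left base is nonnegative, and
`‖X u‖² ≤ (‖Pᵢ u‖ + n/100 + n (n − 1) · 251/10000)²` always. [folklore] -/
theorem tube_ballRange_sq : ∀ (S : Set (EuclideanSpace ℝ (Fin 3))), (∀ x ∈ S, GoodShell S x) → HcpCharted S → ∀ X : ℤ × ℤ × ℤ → EuclideanSpace ℝ (Fin 3), IsRootedChart S X → ∀ (n : ℕ), ∀ u ∈ ballLabels n, (0 ≤ 9 / 10 * (‖hcpSite 1 (Real.sqrt (2 / 3)) u‖ - (n : ℝ) / 100) - (n : ℝ) * ((n : ℝ) - 1) * (251 / 10000) → (9 / 10 * (‖hcpSite 1 (Real.sqrt (2 / 3)) u‖ - (n : ℝ) / 100) - (n : ℝ) * ((n : ℝ) - 1) * (251 / 10000)) ^ 2 ≤ ‖X u‖ ^ 2) ∧ ‖X u‖ ^ 2 ≤ (‖hcpSite 1 (Real.sqrt (2 / 3)) u‖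 + (n : ℝ) / 100 + (n : ℝ) * ((n : ℝ) - 1) * (251 / 10000)) ^ 2 := by
  intro S hgood hch X hX n u hu
  obtain ⟨hlo, hhi⟩ := tube_ballRange S hgood hch X hX n u hu
  exact ⟨fun h0 => pow_le_pow_left₀ h0 hlo 2, pow_le_pow_left₀ (norm_nonneg _) hhi 2⟩

end Summit.AtomisticToContinuum.Crystallization.Theorems.PalmUnimodularRigidity.LayeredLawsSelectHcp

end
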